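import Literature.Barriers.KontsevichZagierPeriods.PeriodEqualityDecidability
import Literature.NumberTheory.Transcendental.KZProductIdeal
import Literature.NumberTheory.Transcendental.KZKernelConjectureForms
import Summits.KontsevichZagierPeriods.KontsevichZagierPeriods.Statement
import HarnessLib
import HarnessLib.Audit

/-!
# SoloInformed — Problem 1 needs only the LOCALISED conjecture: `KZ.PiLocalKernel` alone decides equality of periods on effective codings

Kontsevich–Zagier's **Problem 1** [Kontsevich–Zagier 2001, §1.2: "Find an algorithm to determine
whether or not two given numbers in `P` are equal"] is predicted to follow from Conjecture 1
["[Conjecture 1] would entail that equality of periods is decidable", Kenison et al. 2021,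
App. A.2; "the Kontsevich–Zagier and Grothendieck period conjectures predict that equality between
periods should be decidable", Sertöz–Ouaknine–Worrell 2025, (1.0.1)], and the tree makes this
precise as `Literature.Barriers.KontsevichZagierPeriods.KZ.decidable_value_eq_of_complete`: the
summit `KontsevichZagierPeriods` (the two-representation form of Conjecture 1) gives decidable
value-equality on every coding of rational representations with uniformly computable values on
which KZ-derivability `KZ.Equivalent` is r.e.

This file shows that **the full conjecture is not what Problem 1 uses.**  The summit splits,
hypothesis-free, as `KontsevichZagierPeriods ↔ KZ.PiLocalKernel ∧ KZ.PiCancellation`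
(`Theorems/SoloInformedPiLocalAnchor.lean`, `soloInformed_kzp_iff_piLocalKernel_and_piCancellation`;
not imported here), where

* `KZ.PiLocalKernel` — every formal `ℤ`-combination of representations with value `0` becomes a
  relation after multiplication by some power of the disc `[π]` — is the KZ-calculus transcription
  of the period conjecture for the LOCALISED ring `P̂ = P[π⁻¹]` [Kontsevich–Zagier 2001, §4.1;
  Ayoub 2014, Def. 6 and Conj. 7], equivalently injectivity of `P[⟦[π]⟧⁻¹] → ℝ`
  (`soloInformed_piLocalKernel_iff_injective_awayLift`), and
* `KZ.PiCancellation` — `[π]·c ∈ relations ⇒ c ∈ relations` — is the residual "effective versus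
  localised" statement whose motivic shadow (fullness of effective Nori motives) Huber–Wüstholz
  leave open [Huber–Wüstholz 2022, App. A.3–A.4].

**Theorem (`soloInformed_decidable_value_eq_of_piLocalKernel`).** `KZ.PiLocalKernel` ALONE implies
decidable equality of values on every coding `code : ι → Σ n, KZ.IntegralRep n` (no rationality
hypothesis) with uniformly computable values, r.e. KZ-derivability, and a computable map
`disc : ι → ι` realising the disc move up to the moves (`code (disc i) ∼ [π]·code i`; for a Gödel
numbering of KZ's syntax `disc` is the syntactic product with the unit disc and the hypothesis holds
with equality).  The mechanism (`soloInformed_value_eq_iff_exists_equivalent_discIter`): under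
`KZ.PiLocalKernel`,

  `value (code i) = value (code j)  ⟺  ∃ k, code (disc^[k] i) ∼ code (disc^[k] j)`,

whose right-hand side is r.e. (projection of an r.e. predicate along the computable iteration of
`disc`, `soloInformed_rePred_exists`), so value-equality is r.e.; uniform computability makes
inequality r.e.; Post.  `KZ.PiCancellation` is never used.

**Contrapositive (`soloInformed_not_piLocalKernel_of_undecidable`).** An undecidability theorem for
equality of periods on such a coding refutes not merely Conjecture 1 (the barrier file's
`KZ.not_complete_of_undecidable`) but already the localised conjecture `P̂ ↪ ℝ` — Ayoub's
Conjecture 7 for this calculus — and says nothing about `KZ.PiCancellation`.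

Since the summit implies `KZ.PiLocalKernel` with exponent `0` (`soloInformed_piLocalKernel_of_kzp`,
one line over `KZ.piLocalKernel_of_kernel`), the barrier's theorem is recovered for disc-closed
codings without its rationality hypothesis (`soloInformed_decidable_value_eq_of_kzp`).

All statements are over the Literature library (`KZCalculus`, `KZProduct`, `KZProductIdeal`,
`KZKernelConjectureForms`, `Barriers/…/PeriodEqualityDecidability`), the summit `Statement`, and
Mathlib's computability library; no `SoloInformed*` module is imported.

References: M. Kontsevich, D. Zagier, *Periods* (2001), §1.2 (Conjecture 1, Problem 1), §4.1;
J. Ayoub, *Periods and the conjectures of Grothendieck and Kontsevich–Zagier*, EMS Newsl. 91 (2014),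
Def. 6, Conj. 7; A. Huber, G. Wüstholz, *Transcendence and linear relations of 1-periods* (2022),
App. A.3–A.4; G. Kenison et al. (2021), App. A.2; E. C. Sertöz, J. Ouaknine, J. Worrell (2025),
(1.0.1); M. Yoshinaga, *Periods and elementary real numbers* (2008), Thm 18 (pointwise computability
of real periods — the motivation for the hypothesis `UniformlyComputable`); E. Post (r.e. and
co-r.e. ⇒ decidable; Mathlib `ComputablePred.computable_iff_re_compl_re'`).
-/

open Literature.NumberTheory.Transcendental Literature.NumberTheory.Transcendental.KZ
open Literature.Barriers.KontsevichZagierPeriods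
open Encodable

namespace Summit.KontsevichZagierPeriods.KontsevichZagierPeriods.Theorems

/-! ### Powers of the disc move on formal combinations -/

/-- One more left multiplication by the disc: `([π]·)^[k+1] c = ([π]·)^[k] ([π]·c)`
(definitional unfolding of `Function.iterate`). [folklore] -/
theorem soloInformed_piMul_iterate_succ (k : ℕ) (c : FormalRep) :
    (fun x => of piRep * x)^[k + 1] c = (fun x => of piRep * x)^[k] (of piRep * c) := rfl

/-- **Soundness half (hypothesis-free).** If some `[π]`-power multiple of `[r] - [r']` is a
relation, then `r` and `r'` have the same value: relations evaluate to `0`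
(`KZ.relations_le_ker_eval_holds`), `eval (([π]·)^[N] c) = π ^ N · eval c` (by `KZ.eval_piRep_mul`;
this identity and the additivity of `([π]·)^[N]` are landed elsewhere in the tree, in a module this
file cannot import, and are re-derived here as local steps), and `π ≠ 0`.
[Kontsevich–Zagier 2001, §1.2] -/
theorem soloInformed_value_eq_of_piIter_sub_mem {n m : ℕ} (r : IntegralRep n) (r' : IntegralRep m)
    {N : ℕ} (h : (fun x => of piRep * x)^[N] (of r - of r') ∈ relations) :
    r.value = r'.value := by
  have hev : ∀ (M : ℕ) (c : FormalRep),
      eval ((fun x => of piRep * x)^[M] c) = Real.pi ^ M * eval c := by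
    intro M
    induction M with
    | zero => intro c; simp
    | succ M ih => intro c; rw [soloInformed_piMul_iterate_succ, ih, eval_piRep_mul, pow_succ]; ring
  have h0 : eval ((fun x => of piRep * x)^[N] (of r - of r')) = 0 := by
    have h1 := relations_le_ker_eval_holds h
    rwa [AddMonoidHom.mem_ker] at h1
  rw [hev, map_sub, eval_of, eval_of] at h0
  exact sub_eq_zero.mp ((mul_eq_zero.mp h0).resolve_left (pow_ne_zero _ Real.pi_ne_zero))

/-- **Under `KZ.PiLocalKernel`, equality of values is an existential statement over the moves:**
`value r = value r' ⟺ ∃ N, ([π]·)^[N] ([r] - [r']) ∈ relations`.  Forward: `KZ.PiLocalKernel`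
applied to `c = [r] - [r']`, which has value `0`; backward: `soloInformed_value_eq_of_piIter_sub_mem`.
No rationality hypothesis and no `KZ.PiCancellation`. [Ayoub 2014, Conj. 7 (KZ-calculus form
`KZ.PiLocalKernel`)] -/
theorem soloInformed_value_eq_iff_exists_piIter_sub_mem (hloc : PiLocalKernel) {n m : ℕ}
    (r : IntegralRep n) (r' : IntegralRep m) :
    r.value = r'.value ↔ ∃ N : ℕ, (fun x => of piRep * x)^[N] (of r - of r') ∈ relations := by
  refine ⟨fun h => hloc _ ?_, fun ⟨N, hN⟩ => soloInformed_value_eq_of_piIter_sub_mem r r' hN⟩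
  rw [map_sub, eval_of, eval_of, h, sub_self]

/-- Congruence of differences modulo an additive subgroup: if `A ≡ A'` and `B ≡ B'` then
`A - B ∈ H ↔ A' - B' ∈ H`. [folklore] -/
theorem soloInformed_sub_mem_iff_of_congr {G : Type*} [AddCommGroup G] (H : AddSubgroup G)
    {A B A' B' : G} (hA : A - A' ∈ H) (hB : B - B' ∈ H) : A - B ∈ H ↔ A' - B' ∈ H := by
  constructor
  · intro h
    have h1 := H.sub_mem h (H.sub_mem hA hB)
    rwa [show A - B - (A - A' - (B - B')) = A' - B' by abel] at h1
  · intro h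
    have h1 := H.add_mem h (H.sub_mem hA hB)
    rwa [show A' - B' + (A - A' - (B - B')) = A - B by abel] at h1

/-! ### Codings closed under the disc move -/

section Coding

variable {ι : Type*}

/-- **Transport along a coding closed under the disc move.** If `code (disc i) ∼ [π]·code i` for
every code `i`, then for every `k` the codes `disc^[k] i`, `disc^[k] j` carry KZ-equivalent
representations iff `([π]·)^[k] ([code i] - [code j])` is a relation.  (Induction on `k`;
`[π]·[s] = [[π] × s]` is `KZ.of_mul_of`, relations are stable under `[π]·`
by `KZ.piRep_mul_iterate_mem_relations`.) [Kontsevich–Zagier 2001, §1.2 (the moves); folklore] -/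
theorem soloInformed_equivalent_discIter_iff (code : ι → Σ n, IntegralRep n) (disc : ι → ι)
    (hd : ∀ i, Equivalent (code (disc i)).2 (piRep.prod (code i).2)) (k : ℕ) (i j : ι) :
    Equivalent (code (disc^[k] i)).2 (code (disc^[k] j)).2 ↔
      (fun x => of piRep * x)^[k] (of (code i).2 - of (code j).2) ∈ relations := by
  -- additivity of `([π]·)^[N]` (re-derived locally, see `soloInformed_value_eq_of_piIter_sub_mem`)
  have hsub : ∀ (N : ℕ) (a b : FormalRep), (fun x => of piRep * x)^[N] (a - b) =
      (fun x => of piRep * x)^[N] a - (fun x => of piRep * x)^[N] b := by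
    intro N
    induction N with
    | zero => intro a b; rfl
    | succ N ih => intro a b; rw [soloInformed_piMul_iterate_succ, soloInformed_piMul_iterate_succ,
        soloInformed_piMul_iterate_succ, mul_sub, ih]
  induction k generalizing i j with
  | zero => rfl
  | succ k ih =>
    rw [Function.iterate_succ_apply disc k i, Function.iterate_succ_apply disc k j]
    refine (ih (disc i) (disc j)).trans ?_
    rw [soloInformed_piMul_iterate_succ, mul_sub, of_mul_of, of_mul_of, hsub, hsub]
    have hi : (fun x => of piRep * x)^[k] (of (code (disc i)).2) -
        (fun x => of piRep * x)^[k] (of (piRep.prod (code i).2)) ∈ relations := by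
      rw [← hsub]; exact piRep_mul_iterate_mem_relations k (hd i)
    have hj : (fun x => of piRep * x)^[k] (of (code (disc j)).2) -
        (fun x => of piRep * x)^[k] (of (piRep.prod (code j).2)) ∈ relations := by
      rw [← hsub]; exact piRep_mul_iterate_mem_relations k (hd j)
    exact soloInformed_sub_mem_iff_of_congr relations hi hj

/-- **The mechanism.** Under `KZ.PiLocalKernel`, on a coding closed under the disc move two codes
have the same value iff, after multiplying both by the SAME power of the disc, their
representations are connected by the Kontsevich–Zagier moves:
`value (code i) = value (code j) ⟺ ∃ k, code (disc^[k] i) ∼ code (disc^[k] j)`.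
[Ayoub 2014, Conj. 7 (as `KZ.PiLocalKernel`); Kontsevich–Zagier 2001, §1.2 and §4.1] -/
theorem soloInformed_value_eq_iff_exists_equivalent_discIter (hloc : PiLocalKernel)
    (code : ι → Σ n, IntegralRep n) (disc : ι → ι)
    (hd : ∀ i, Equivalent (code (disc i)).2 (piRep.prod (code i).2)) (i j : ι) :
    (code i).2.value = (code j).2.value ↔
      ∃ k : ℕ, Equivalent (code (disc^[k] i)).2 (code (disc^[k] j)).2 := by
  rw [soloInformed_value_eq_iff_exists_piIter_sub_mem hloc]
  exact exists_congr fun k => (soloInformed_equivalent_discIter_iff code disc hd k i j).symm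

/-! ### Recursion-theoretic lemmas -/

variable [Primcodable ι]

/-- Iterating a computable self-map is computable, uniformly in the number of iterations
(primitive recursion, Mathlib `Computable.nat_rec`). [folklore] -/
theorem soloInformed_computable_iterate {d : ι → ι} (hd : Computable d) :
    Computable fun p : ℕ × ι => d^[p.1] p.2 := by
  have h := Computable.nat_rec (f := fun p : ℕ × ι => p.1) (g := fun p : ℕ × ι => p.2)
    (h := fun (_ : ℕ × ι) (q : ℕ × ι) => d q.2) Computable.fst Computable.snd
    (hd.comp (Computable.snd.comp Computable.snd)).to₂
  refine h.of_eq ?_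
  rintro ⟨k, i⟩
  dsimp only
  induction k with
  | zero => rfl
  | succ k ih => rw [Function.iterate_succ_apply', ← ih]

/-- r.e. predicates are stable under computable substitution. [folklore] -/
theorem soloInformed_rePred_comp {α β : Type*} [Primcodable α] [Primcodable β] {p : β → Prop}
    (hp : REPred p) {g : α → β} (hg : Computable g) : REPred fun a => p (g a) :=
  Partrec.comp hp hg

/-- **Projection: r.e. predicates are stable under `∃ k : ℕ`.** If `P ⊆ ℕ × α` is r.e. then so is
`{a | ∃ k, P (k, a)}` — dovetail the step-bounded evaluation `Nat.Partrec.Code.evaln` of a code for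
`P`'s semi-decider over (number of steps, witness) and search with `Nat.rfindOpt`. [folklore] -/
theorem soloInformed_rePred_exists {α : Type*} [Primcodable α] {P : ℕ × α → Prop}
    (hP : REPred P) : REPred fun a => ∃ k, P (k, a) := by
  obtain ⟨c, hc⟩ := Nat.Partrec.Code.exists_code.1 hP
  have hf : Computable₂ fun (a : α) (m : ℕ) =>
      Nat.Partrec.Code.evaln m.unpair.1 c (encode (m.unpair.2, a)) := by
    have h : Primrec fun p : α × ℕ =>
        Nat.Partrec.Code.evaln p.2.unpair.1 c (encode (p.2.unpair.2, p.1)) :=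
      Nat.Partrec.Code.primrec_evaln.comp
        (((Primrec.fst.comp (Primrec.unpair.comp Primrec.snd)).pair (Primrec.const c)).pair
          (Primrec.encode.comp
            ((Primrec.snd.comp (Primrec.unpair.comp Primrec.snd)).pair Primrec.fst)))
    exact h.to_comp
  refine (Partrec.dom_re (Partrec.rfindOpt hf)).of_eq fun a => ?_
  rw [Nat.rfindOpt_dom]
  constructor
  · rintro ⟨m, x, hx⟩
    have hx' : x ∈ Nat.Partrec.Code.eval c (encode ((Nat.unpair m).2, a)) :=
      Nat.Partrec.Code.evaln_sound hx
    rw [hc] at hx'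
    simp only [Encodable.encodek, Part.coe_some, Part.bind_some, Part.mem_map_iff,
      Part.mem_assert_iff, Part.mem_some_iff] at hx'
    obtain ⟨_, ⟨hk, _⟩, _⟩ := hx'
    exact ⟨_, hk⟩
  · rintro ⟨k, hk⟩
    have hx : encode () ∈ Nat.Partrec.Code.eval c (encode (k, a)) := by
      rw [hc]
      simp only [Encodable.encodek, Part.coe_some, Part.bind_some, Part.mem_map_iff,
        Part.mem_assert_iff, Part.mem_some_iff]
      exact ⟨(), ⟨hk, trivial⟩, trivial⟩
    obtain ⟨s, hs⟩ := Nat.Partrec.Code.evaln_complete.1 hx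
    exact ⟨Nat.pair s k, encode (), by simpa only [Nat.unpair_pair] using hs⟩

/-! ### `KZ.PiLocalKernel` alone decides equality of values -/

/-- **`KZ.PiLocalKernel` makes value-equality r.e. on every effective disc-closed coding.**
For a coding `code` of integral representations (rational or not) with a computable `disc`
realising the disc move up to the moves (`hd`) and r.e. KZ-derivability (`hre`), the localised
conjecture `KZ.PiLocalKernel` implies that equality of values is r.e.: by
`soloInformed_value_eq_iff_exists_equivalent_discIter` it is the projection along `k` of the r.e.
predicate `code (disc^[k] i) ∼ code (disc^[k] j)`.  `KZ.PiCancellation` is not used.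
[Ayoub 2014, Conj. 7; Kontsevich–Zagier 2001, §1.2 Conjecture 1 (the calculus)] -/
theorem soloInformed_rEEq_of_piLocalKernel (hloc : PiLocalKernel)
    (code : ι → Σ n, IntegralRep n) (disc : ι → ι) (hdisc : Computable disc)
    (hd : ∀ i, Equivalent (code (disc i)).2 (piRep.prod (code i).2))
    (hre : REPred fun p : ι × ι => Equivalent (code p.1).2 (code p.2).2) :
    REEq fun i => (code i).2.value := by
  have hG : Computable fun q : ℕ × (ι × ι) => (disc^[q.1] q.2.1, disc^[q.1] q.2.2) :=
    ((soloInformed_computable_iterate hdisc).comp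
        (Computable.fst.pair (Computable.fst.comp Computable.snd))).pair
      ((soloInformed_computable_iterate hdisc).comp
        (Computable.fst.pair (Computable.snd.comp Computable.snd)))
  -- `hQ : REPred fun q => code (disc^[q.1] q.2.1) ∼ code (disc^[q.1] q.2.2)` (type left to
  -- inference: an ascription here sends the unifier into higher-order search).
  have hQ := soloInformed_rePred_comp hre hG
  refine (soloInformed_rePred_exists hQ).of_eq fun p => ?_
  dsimp only
  exact (soloInformed_value_eq_iff_exists_equivalent_discIter hloc code disc hd p.1 p.2).symm

/-- **`KZ.PiLocalKernel` alone solves Problem 1 on effective disc-closed codings.** If the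
localised period conjecture `KZ.PiLocalKernel` holds (Ayoub's Conjecture 7 for this calculus;
injectivity of `P[⟦[π]⟧⁻¹] → ℝ`), then for every coding of integral representations with
uniformly computable values (`hcomp`; pointwise this is Yoshinaga's theorem), a computable disc
move (`hdisc`, `hd`) and r.e. KZ-derivability (`hre`), equality of the represented periods is
decidable (r.e. by `soloInformed_rEEq_of_piLocalKernel`, co-r.e. by uniform computability, Post:
`REEq.decidableEquality_of_uniformlyComputable`).  Compared with the barrier file's
`KZ.decidable_value_eq_of_complete` the hypothesis drops from the summit (`= KZ.PiLocalKernel ∧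
KZ.PiCancellation`) to its first conjunct and the rationality hypothesis disappears; the price is
the disc-closure of the coding, automatic for a Gödel numbering of KZ's syntax.
[Kontsevich–Zagier 2001, §1.2 Problem 1; Kenison et al. 2021, App. A.2; Sertöz–Ouaknine–Worrell
2025, (1.0.1); Ayoub 2014, Conj. 7; Yoshinaga 2008, Thm 18] -/
theorem soloInformed_decidable_value_eq_of_piLocalKernel (hloc : PiLocalKernel)
    (code : ι → Σ n, IntegralRep n) (disc : ι → ι) (hdisc : Computable disc)
    (hd : ∀ i, Equivalent (code (disc i)).2 (piRep.prod (code i).2))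
    (hcomp : UniformlyComputable fun i => (code i).2.value)
    (hre : REPred fun p : ι × ι => Equivalent (code p.1).2 (code p.2).2) :
    DecidableEquality fun i => (code i).2.value :=
  (soloInformed_rEEq_of_piLocalKernel hloc code disc hdisc hd hre)
    |>.decidableEquality_of_uniformlyComputable hcomp

/-- **Contrapositive: undecidability of period equality refutes already the LOCALISED conjecture.**
An undecidability theorem for equality of values on a coding with uniformly computable values, a
computable disc move and r.e. KZ-derivability refutes `KZ.PiLocalKernel` — the KZ-calculus form
of `P̂ = P[π⁻¹] ↪ ℝ`, Ayoub's Conjecture 7 — and not merely Conjecture 1 (the barrier's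
`KZ.not_complete_of_undecidable`); it has no bearing on `KZ.PiCancellation`.  As for the barrier,
the premise is open: no undecidability theorem for equality of periods is known
[Sertöz–Ouaknine–Worrell 2025, (1.0.1)]. [Ayoub 2014, Conj. 7; Kontsevich–Zagier 2001, §1.2] -/
theorem soloInformed_not_piLocalKernel_of_undecidable
    (code : ι → Σ n, IntegralRep n) (disc : ι → ι) (hdisc : Computable disc)
    (hd : ∀ i, Equivalent (code (disc i)).2 (piRep.prod (code i).2))
    (hcomp : UniformlyComputable fun i => (code i).2.value)
    (hre : REPred fun p : ι × ι => Equivalent (code p.1).2 (code p.2).2)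
    (hU : ¬ DecidableEquality fun i => (code i).2.value) : ¬ PiLocalKernel :=
  fun hloc => hU (soloInformed_decidable_value_eq_of_piLocalKernel hloc code disc hdisc hd hcomp hre)

end Coding

/-! ### Comparison with the summit -/

/-- The summit implies the localised conjecture, with exponent `0`: `KontsevichZagierPeriods` is
the kernel conjecture `ker eval = relations` (`kzKernelConjecture_iff_isRational`), which gives
`KZ.PiLocalKernel` by `KZ.piLocalKernel_of_kernel`.  (This is the first projection of
`soloInformed_kzp_iff_piLocalKernel_and_piCancellation`, re-derived so that this file does not
import `SoloInformedPiLocalAnchor`.) [folklore] -/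
theorem soloInformed_piLocalKernel_of_kzp (h : KontsevichZagierPeriods) : PiLocalKernel :=
  piLocalKernel_of_kernel (kzKernelConjecture_iff_isRational.2 (KontsevichZagierPeriods_iff.1 h))

/-- **The summit decides equality on effective disc-closed codings, with no rationality
hypothesis** — the barrier's `KZ.decidable_value_eq_of_complete` through `KZ.PiLocalKernel`
(`soloInformed_piLocalKernel_of_kzp` + `soloInformed_decidable_value_eq_of_piLocalKernel`): the
hypothesis `hrat` there is traded for the disc-closure `hd`. [Kontsevich–Zagier 2001, §1.2
Problem 1; Kenison et al. 2021, App. A.2] -/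
theorem soloInformed_decidable_value_eq_of_kzp {ι : Type*} [Primcodable ι]
    (h : KontsevichZagierPeriods) (code : ι → Σ n, IntegralRep n) (disc : ι → ι)
    (hdisc : Computable disc) (hd : ∀ i, Equivalent (code (disc i)).2 (piRep.prod (code i).2))
    (hcomp : UniformlyComputable fun i => (code i).2.value)
    (hre : REPred fun p : ι × ι => Equivalent (code p.1).2 (code p.2).2) :
    DecidableEquality fun i => (code i).2.value :=
  soloInformed_decidable_value_eq_of_piLocalKernel (soloInformed_piLocalKernel_of_kzp h) code disc
    hdisc hd hcomp hre

end Summit.KontsevichZagierPeriods.KontsevichZagierPeriods.Theorems
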